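import Summits.Ventures.HodgeRepro.Night3GSetForm
import Summits.Ventures.HodgeRepro.Night3GSetKunnethOther
import Summits.Ventures.HodgeRepro.Night3GSetCorrespondence
import Summits.Ventures.HodgeRepro.Night3GradedComm
import Summits.Ventures.HodgeRepro.Night3Poincare

/-!
# Künneth multiplicativity of Weil's class and of the concrete form: `Λ_{M+N} = Λ_M × Λ_N` and
`Q′_{M+N}(x × x′, y × y′) = (−1)^{|N||M|} Q′_M(x, y) Q′_N(x′, y′)`

Blind re-derivation cell `pub-hodge-repro`, seat `night-3` (gen 6, row E; NIGHT3.md §13.9).  Imports gen 5's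
`Night3GSetForm` (`ωc`, `Lclass`, `Λc`, `Qc`), gen 4's `Night3GSetKunnethOther` (the lex wedge basis in every degree,
`blocksUnionPCD`, `coe_wedgeBasisD_blocksUnionPCD`: `e_{inl T₁ ⊔ inr T₂} = (map inl e_{T₁}) * (map inr e_{T₂})` with sign
`+1`), gen 5's `Night3GSetCorrespondence` (`map_mem_exteriorPower`), gen 6's `Night3GradedComm` (graded commutativity)
and `Night3Poincare` (`mul_mem_add`, `ιMultiDual_univPC_congr`).  Namespace `HodgeRepro.Night3.GSetModel`.

With `ι_L = ExteriorAlgebra.map (inlMap n k)`, `ι_R = ExteriorAlgebra.map (inrMap n k)` the algebra maps of the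
coordinate inclusions `V_n, V_k → V_{n+k}`, the cross product `cross x x′ = ι_L x * ι_R x′ ∈ ⋀^{n+k} V_{n+k}`, and the
coefficient data `Fin.append a a′` of the product `B_M × B_N`:

* `ωc_castAdd` / `ωc_natAdd`, `coe_Lclass_append_castAdd` / `_natAdd`: the `(1,1)`-classes of the factors of the
  product are the images of those of `B_M`, `B_N`;
* **`coe_Λc_append`**: `Λ_{M+N} = ι_L Λ_M * ι_R Λ_N` — Weil's class of the product is the product of the Weil classes;
* `eq_top_smul_topE`, `blocksUnionPCD_univ_univ`, **`ιMultiDual_univPC_map_mul_map`**: the top form is multiplicative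
  with sign `+1`: `∫_{n+k} (ι_L w * ι_R w′) = ∫_n w · ∫_k w′` (the lex enumeration of the union of the two blocks is
  the concatenation);
* `cross_mul_cross_mul`: the graded rearrangement `(x x′)(y y′)(Λ Λ′) = (−1)^{kn} (x y Λ)(x′ y′ Λ′)`;
* **`Qc_cross_cross`**: `Q′_{M+N}(x × x′, y × y′) = (−1)^{kn} Q′_M(x, y) Q′_N(x′, y′)`;
* **`Qc_append_line_line`**: the monomial Gram matrix is multiplicative on the lines (`coe_line_add`).

READING: the route's form on `B_M × B_N` is the product of the forms of the factors (with
`Λ_{M×N} = pr_M^* Λ_M ∪ pr_N^* Λ_N`); the sign `(−1)^{|M||N|}` is the graded-commutativity sign of the cup product,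
`+1` whenever `|M|` is even (every zero-sum `M`).  `Alg` is not mentioned; nothing here closes S4; nothing here says
anything about the status of the Hodge conjecture for CM abelian varieties, which is NOT proved.
-/

set_option autoImplicit false
open Finset Module
open scoped Pointwise IsMulCommutative
namespace HodgeRepro.Night3.GSetModel

open HodgeRepro.CMHodgeOn ExteriorAlgebra

variable {G : Type*} [Group G] [Fintype G] [DecidableEq G] [LinearOrder G]

/-! ### Weil's class of a product -/

section Lambda

variable (c : G) (Φ₀ : Finset G) {n k : ℕ}

omit [LinearOrder G] in
/-- The monomial of the product at a block-1 index is `ι_L` of the monomial of the first factor. -/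
theorem ωc_castAdd (i : Fin n) (ρ : G) :
    ωc c (n + k) (Fin.castAdd k i, ρ) = ExteriorAlgebra.map (inlMap n k) (ωc c n (i, ρ)) := by
  rw [ωc_apply, ωc_apply, map_mul, ExteriorAlgebra.map_apply_ι, ExteriorAlgebra.map_apply_ι, inlMap_coordVecOn,
    inlMap_coordVecOn]
  rfl

omit [LinearOrder G] in
/-- The monomial of the product at a block-2 index is `ι_R` of the monomial of the second factor. -/
theorem ωc_natAdd (j : Fin k) (ρ : G) :
    ωc c (n + k) (Fin.natAdd n j, ρ) = ExteriorAlgebra.map (inrMap n k) (ωc c k (j, ρ)) := by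
  rw [ωc_apply, ωc_apply, map_mul, ExteriorAlgebra.map_apply_ι, ExteriorAlgebra.map_apply_ι, inrMap_coordVecOn,
    inrMap_coordVecOn]
  rfl

omit [LinearOrder G] in
/-- The `(1,1)`-class of the factor `i < n` of the product is `ι_L` of the `i`-th class of `B_M`. -/
theorem coe_Lclass_append_castAdd (a : Fin n → G → ℂ) (a' : Fin k → G → ℂ) (i : Fin n) :
    (Lclass c Φ₀ (Fin.append a a') (Fin.castAdd k i) : ExteriorAlgebra ℂ (V G (n + k))) =
      ExteriorAlgebra.map (inlMap n k) (Lclass c Φ₀ a i) := by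
  simp only [Lclass, AddSubmonoidClass.coe_finsetSum, Subalgebra.coe_smul, ExtTop.coe_ω', map_sum, map_smul,
    Fin.append_left]
  exact Finset.sum_congr rfl fun ρ _ => by rw [← ωc_castAdd]

omit [LinearOrder G] in
/-- The `(1,1)`-class of the factor `n + j` of the product is `ι_R` of the `j`-th class of `B_N`. -/
theorem coe_Lclass_append_natAdd (a : Fin n → G → ℂ) (a' : Fin k → G → ℂ) (j : Fin k) :
    (Lclass c Φ₀ (Fin.append a a') (Fin.natAdd n j) : ExteriorAlgebra ℂ (V G (n + k))) =
      ExteriorAlgebra.map (inrMap n k) (Lclass c Φ₀ a' j) := by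
  simp only [Lclass, AddSubmonoidClass.coe_finsetSum, Subalgebra.coe_smul, ExtTop.coe_ω', map_sum, map_smul,
    Fin.append_right]
  exact Finset.sum_congr rfl fun ρ _ => by rw [← ωc_natAdd]

omit [DecidableEq G] [LinearOrder G] in
/-- A finset product in `Ac c (n + k)` of images under an algebra map of elements of `Ac c n′` is the image of the
product (the ambient exterior algebra is not commutative: induction on the finset). -/
theorem coe_prod_eq_map_coe_prod {n' : ℕ} (f : V G n' →ₗ[ℂ] V G (n + k)) {ι : Type*} (s : Finset ι)
    (F : ι → Ac c (n + k)) (F' : ι → Ac c n')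
    (h : ∀ i ∈ s, (F i : ExteriorAlgebra ℂ (V G (n + k))) = ExteriorAlgebra.map f (F' i)) :
    ((∏ i ∈ s, F i : Ac c (n + k)) : ExteriorAlgebra ℂ (V G (n + k))) =
      ExteriorAlgebra.map f ((∏ i ∈ s, F' i : Ac c n') : ExteriorAlgebra ℂ (V G n')) := by
  classical
  induction s using Finset.induction_on with
  | empty => rw [prod_empty, prod_empty, Subalgebra.coe_one, Subalgebra.coe_one, map_one]
  | insert i s hi ih =>
    rw [prod_insert hi, prod_insert hi, Subalgebra.coe_mul, Subalgebra.coe_mul, map_mul,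
      h i (mem_insert_self i s), ih fun j hj => h j (mem_insert_of_mem hj)]

omit [LinearOrder G] in
/-- **Weil's class of the product is the product of the Weil classes**: `Λ_{M+N} = ι_L Λ_M * ι_R Λ_N`. -/
theorem coe_Λc_append (a : Fin n → G → ℂ) (a' : Fin k → G → ℂ) :
    (Λc c Φ₀ (Fin.append a a') : ExteriorAlgebra ℂ (V G (n + k))) =
      ExteriorAlgebra.map (inlMap n k) (Λc c Φ₀ a) * ExteriorAlgebra.map (inrMap n k) (Λc c Φ₀ a') := by
  rw [Λc, Λc, Λc, Fin.prod_univ_add, Subalgebra.coe_mul]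
  congr 1
  · exact coe_prod_eq_map_coe_prod c (inlMap n k) univ _ _ fun i _ => by
      rw [Subalgebra.coe_pow, Subalgebra.coe_pow, map_pow, coe_Lclass_append_castAdd]
  · exact coe_prod_eq_map_coe_prod c (inrMap n k) univ _ _ fun j _ => by
      rw [Subalgebra.coe_pow, Subalgebra.coe_pow, map_pow, coe_Lclass_append_natAdd]

end Lambda

/-! ### The top form of a product is the product of the top forms (sign `+1`) -/

section Top

variable (n k : ℕ)

omit [Group G] [DecidableEq G] [LinearOrder G] in
/-- `|Fin (n + k) × G| = |Fin n × G| + |Fin k × G|`. -/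
theorem card_lex_add :
    Fintype.card (Lex (Fin (n + k) × G)) = Fintype.card (Lex (Fin n × G)) + Fintype.card (Lex (Fin k × G)) := by
  show Fintype.card (Fin (n + k) × G) = Fintype.card (Fin n × G) + Fintype.card (Fin k × G)
  simp only [Fintype.card_prod, Fintype.card_fin]
  ring

omit [Group G] [DecidableEq G] in
/-- In the top degree every element is its top coordinate times the top basis vector `e_univ`. -/
theorem eq_top_smul_topE {N : ℕ} (hN : Fintype.card (Lex (Fin n × G)) = N) (w : ⋀[ℂ]^N (V G n)) :
    w = exteriorPower.ιMultiDual ℂ N (lexBasis n) (ExtTop.univPC hN) w • wedgeBasisD n N (ExtTop.univPC hN) := by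
  classical
  conv_lhs => rw [← (wedgeBasisD n N).sum_repr w]
  rw [Finset.sum_eq_single (ExtTop.univPC hN)]
  · rw [wedgeBasisD, exteriorPower.basis_repr_apply]
  · intro T _ hT
    exact absurd (Subtype.ext (Finset.eq_univ_of_card _ (by rw [Set.powersetCard.card_eq, hN]))) hT
  · intro h
    exact absurd (Finset.mem_univ _) h

omit [Group G] [LinearOrder G] in
/-- The union of the two full blocks is everything. -/
theorem blocksUnionPCD_univ_univ {N N' : ℕ} (hN : Fintype.card (Lex (Fin n × G)) = N)
    (hN' : Fintype.card (Lex (Fin k × G)) = N') (hNN : Fintype.card (Lex (Fin (n + k) × G)) = N + N') :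
    blocksUnionPCD n k N N' (ExtTop.univPC hN) (ExtTop.univPC hN') = ExtTop.univPC hNN := by
  apply Subtype.ext
  rw [blocksUnionPCD, coe_toPC]
  exact Finset.eq_univ_of_card _ (by
    rw [card_blocksUnion]
    show (Finset.univ : Finset (Lex (Fin n × G))).card + (Finset.univ : Finset (Lex (Fin k × G))).card = _
    rw [Finset.card_univ, Finset.card_univ, hN, hN', hNN])

omit [Group G] [DecidableEq G] in
/-- **The top form is multiplicative (sign `+1`)**: `∫_{n+k} (ι_L w * ι_R w′) = ∫_n w · ∫_k w′` for `w`, `w′` of top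
degree (in the lex order block 1 precedes block 2, so the enumeration of the union is the concatenation). -/
theorem ιMultiDual_univPC_map_mul_map {N N' D : ℕ} (hN : Fintype.card (Lex (Fin n × G)) = N)
    (hN' : Fintype.card (Lex (Fin k × G)) = N') (hD : Fintype.card (Lex (Fin (n + k) × G)) = D)
    (w : ⋀[ℂ]^N (V G n)) (w' : ⋀[ℂ]^N' (V G k))
    (H : ExteriorAlgebra.map (inlMap n k) (w : ExteriorAlgebra ℂ (V G n)) *
      ExteriorAlgebra.map (inrMap n k) (w' : ExteriorAlgebra ℂ (V G k)) ∈ ⋀[ℂ]^D (V G (n + k))) :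
    exteriorPower.ιMultiDual ℂ D (lexBasis (n + k)) (ExtTop.univPC hD)
        ⟨ExteriorAlgebra.map (inlMap n k) (w : ExteriorAlgebra ℂ (V G n)) *
          ExteriorAlgebra.map (inrMap n k) (w' : ExteriorAlgebra ℂ (V G k)), H⟩ =
      exteriorPower.ιMultiDual ℂ N (lexBasis n) (ExtTop.univPC hN) w *
        exteriorPower.ιMultiDual ℂ N' (lexBasis k) (ExtTop.univPC hN') w' := by
  have hNN : Fintype.card (Lex (Fin (n + k) × G)) = N + N' := by rw [card_lex_add, hN, hN']
  have H' : ExteriorAlgebra.map (inlMap n k) (w : ExteriorAlgebra ℂ (V G n)) *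
      ExteriorAlgebra.map (inrMap n k) (w' : ExteriorAlgebra ℂ (V G k)) ∈ ⋀[ℂ]^(N + N') (V G (n + k)) :=
    ExtTop.mul_mem_add (map_mem_exteriorPower (inlMap n k) w.2) (map_mem_exteriorPower (inrMap n k) w'.2)
  rw [ExtTop.ιMultiDual_univPC_congr (lexBasis (n + k)) (hD.symm.trans hNN) hD hNN H H']
  have h1 := eq_top_smul_topE n hN w
  have h2 := eq_top_smul_topE k hN' w'
  set cw := exteriorPower.ιMultiDual ℂ N (lexBasis n) (ExtTop.univPC hN) w
  set cw' := exteriorPower.ιMultiDual ℂ N' (lexBasis k) (ExtTop.univPC hN') w'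
  have hel2 : (⟨ExteriorAlgebra.map (inlMap n k) (w : ExteriorAlgebra ℂ (V G n)) *
      ExteriorAlgebra.map (inrMap n k) (w' : ExteriorAlgebra ℂ (V G k)), H'⟩ :
      ⋀[ℂ]^(N + N') (V G (n + k))) = (cw * cw') • wedgeBasisD (n + k) (N + N') (ExtTop.univPC hNN) := by
    ext
    show ExteriorAlgebra.map (inlMap n k) (w : ExteriorAlgebra ℂ (V G n)) *
      ExteriorAlgebra.map (inrMap n k) (w' : ExteriorAlgebra ℂ (V G k)) = _
    rw [← blocksUnionPCD_univ_univ n k hN hN' hNN, Submodule.coe_smul, coe_wedgeBasisD_blocksUnionPCD]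
    conv_lhs => rw [h1, h2]
    simp only [Submodule.coe_smul, map_smul, smul_mul_assoc, mul_smul_comm, smul_smul]
    rw [mul_comm cw' cw]
  rw [hel2, map_smul, smul_eq_mul, wedgeBasisD, exteriorPower.basis_apply, exteriorPower.ιMultiDual_apply_diag,
    mul_one]

end Top

/-! ### The form of a product is the product of the forms -/

section Form

/-- The graded rearrangement `(x x′)(y y′)(Λ Λ′) = (−1)^{kn} (x y Λ)(x′ y′ Λ′)` for `y ∈ ⋀^n`, `x′, y′ ∈ ⋀^k`,
`Λ ∈ ⋀^{2p}` (even degree). -/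
theorem cross_mul_cross_mul {R : Type*} [CommRing R] {M : Type*} [AddCommGroup M] [Module R M] {n k p : ℕ}
    {x y x' y' Λ Λ' : ExteriorAlgebra R M} (hy : y ∈ ⋀[R]^n M) (hx' : x' ∈ ⋀[R]^k M) (hy' : y' ∈ ⋀[R]^k M)
    (hΛ : Λ ∈ ⋀[R]^(2 * p) M) :
    x * x' * (y * y') * (Λ * Λ') = (-1 : R) ^ (k * n) • (x * y * Λ * (x' * y' * Λ')) := by
  have h1 : x' * y = (-1 : R) ^ (k * n) • (y * x') := ExtTop.mul_comm_of_mem hx' hy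
  have h2 : x' * y' * Λ = Λ * (x' * y') :=
    ExtTop.mul_comm_of_mem_even (ExtTop.mul_mem_add hx' hy') hΛ ((Even.add_self k).mul_right _)
  calc x * x' * (y * y') * (Λ * Λ') = x * (x' * y) * y' * Λ * Λ' := by simp only [mul_assoc]
    _ = (-1 : R) ^ (k * n) • (x * y * (x' * y' * Λ) * Λ') := by
        rw [h1]; simp only [mul_smul_comm, smul_mul_assoc, mul_assoc]
    _ = (-1 : R) ^ (k * n) • (x * y * Λ * (x' * y' * Λ')) := by rw [h2]; simp only [mul_assoc]

variable {c : G} (hc : IsComplexConj c) {Φ₀ : Finset G} (hΦ : IsCMType c Φ₀) {n k : ℕ}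

/-- The exterior cross product `x × x′ = ι_L x * ι_R x′ ∈ ⋀^{n+k} V_{n+k}`. -/
noncomputable def cross (x : Hn G n) (x' : Hn G k) : Hn G (n + k) :=
  ⟨ExteriorAlgebra.map (inlMap n k) x * ExteriorAlgebra.map (inrMap n k) x',
    ExtTop.mul_mem_add (map_mem_exteriorPower _ x.2) (map_mem_exteriorPower _ x'.2)⟩

omit [Group G] [Fintype G] [DecidableEq G] [LinearOrder G] in
/-- The underlying element of the cross product. -/
@[simp] theorem coe_cross (x : Hn G n) (x' : Hn G k) :
    (cross x x' : ExteriorAlgebra ℂ (V G (n + k))) =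
      ExteriorAlgebra.map (inlMap n k) x * ExteriorAlgebra.map (inrMap n k) x' := rfl

omit [Group G] in
/-- The `σ`-line of the product is the cross product of the `σ`-lines (gen 4's `coe_line_add`). -/
theorem line_add_eq_cross (σ : G) : line (n + k) σ = cross (line n σ) (line k σ) :=
  Subtype.ext (coe_line_add n k σ)

/-- **The form of the product is the product of the forms**:
`Q′_{M+N}(x × x′, y × y′) = (−1)^{kn} · Q′_M(x, y) · Q′_N(x′, y′)` (coefficient data `Fin.append a a′`). -/
theorem Qc_cross_cross (a : Fin n → G → ℂ) (a' : Fin k → G → ℂ) (x y : Hn G n) (x' y' : Hn G k) :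
    Qc hc hΦ (Fin.append a a') (cross x x') (cross y y') =
      (-1 : ℂ) ^ (k * n) * (Qc hc hΦ a x y * Qc hc hΦ a' x' y') := by
  rw [Qc_apply, Qc_apply, Qc_apply]
  have hΛ : (Λc c Φ₀ a : ExteriorAlgebra ℂ (V G n)) ∈ ⋀[ℂ]^(2 * ((Φ₀.card - 1) * n)) (V G n) := by
    rw [← mul_assoc]; exact coe_Λc_mem c Φ₀ a
  have hmem : ExteriorAlgebra.map (inlMap n k)
        ((x : ExteriorAlgebra ℂ (V G n)) * (y : ExteriorAlgebra ℂ (V G n)) * (Λc c Φ₀ a : ExteriorAlgebra ℂ (V G n))) *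
      ExteriorAlgebra.map (inrMap n k)
        ((x' : ExteriorAlgebra ℂ (V G k)) * (y' : ExteriorAlgebra ℂ (V G k)) * (Λc c Φ₀ a' : ExteriorAlgebra ℂ (V G k))) ∈
      ⋀[ℂ]^(n + k + (n + k) + 2 * (Φ₀.card - 1) * (n + k)) (V G (n + k)) := by
    rw [← card_lex_eq hc hΦ (n + k), card_lex_add n k, card_lex_eq hc hΦ n, card_lex_eq hc hΦ k]
    exact ExtTop.mul_mem_add (map_mem_exteriorPower _ (ExtTop.mul_mul_mem x y (coe_Λc_mem c Φ₀ a)))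
      (map_mem_exteriorPower _ (ExtTop.mul_mul_mem x' y' (coe_Λc_mem c Φ₀ a')))
  have hel : (⟨(cross x x' : ExteriorAlgebra ℂ (V G (n + k))) * cross y y' * Λc c Φ₀ (Fin.append a a'),
      ExtTop.mul_mul_mem (cross x x') (cross y y') (coe_Λc_mem c Φ₀ (Fin.append a a'))⟩ :
      ⋀[ℂ]^(n + k + (n + k) + 2 * (Φ₀.card - 1) * (n + k)) (V G (n + k))) =
      (-1 : ℂ) ^ (k * n) • ⟨ExteriorAlgebra.map (inlMap n k)
          ((x : ExteriorAlgebra ℂ (V G n)) * (y : ExteriorAlgebra ℂ (V G n)) * (Λc c Φ₀ a : ExteriorAlgebra ℂ (V G n))) *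
        ExteriorAlgebra.map (inrMap n k)
          ((x' : ExteriorAlgebra ℂ (V G k)) * (y' : ExteriorAlgebra ℂ (V G k)) * (Λc c Φ₀ a' : ExteriorAlgebra ℂ (V G k))), hmem⟩ := by
    ext
    show (cross x x' : ExteriorAlgebra ℂ (V G (n + k))) * cross y y' * Λc c Φ₀ (Fin.append a a') = _
    rw [Submodule.coe_smul, coe_cross, coe_cross, coe_Λc_append,
      cross_mul_cross_mul (map_mem_exteriorPower _ y.2) (map_mem_exteriorPower _ x'.2)
        (map_mem_exteriorPower _ y'.2) (map_mem_exteriorPower _ hΛ)]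
    simp only [map_mul]
  rw [hel, map_smul, smul_eq_mul]
  congr 1
  exact ιMultiDual_univPC_map_mul_map n k (card_lex_eq hc hΦ n) (card_lex_eq hc hΦ k) (card_lex_eq hc hΦ (n + k))
    ⟨_, ExtTop.mul_mul_mem x y (coe_Λc_mem c Φ₀ a)⟩ ⟨_, ExtTop.mul_mul_mem x' y' (coe_Λc_mem c Φ₀ a')⟩ _

/-- **The monomial Gram matrix is multiplicative**: on the lines of the product,
`Q′_{M+N}(ℓ_σ, ℓ_τ) = (−1)^{kn} Q′_M(ℓ_σ, ℓ_τ) Q′_N(ℓ_σ, ℓ_τ)`. -/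
theorem Qc_append_line_line (a : Fin n → G → ℂ) (a' : Fin k → G → ℂ) (σ τ : G) :
    Qc hc hΦ (Fin.append a a') (line (n + k) σ) (line (n + k) τ) =
      (-1 : ℂ) ^ (k * n) * (Qc hc hΦ a (line n σ) (line n τ) * Qc hc hΦ a' (line k σ) (line k τ)) := by
  rw [line_add_eq_cross, line_add_eq_cross, Qc_cross_cross]

end Form

end HodgeRepro.Night3.GSetModel
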